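import Mathlib.Algebra.Ring.GeomSum
import Literature.Analysis.TotalPositivity.SolidMinorCriterion
import Literature.Analysis.TotalPositivity.ExpPolySolidMinors
import HarnessLib

/-!
# `e^w · P(w/R) ∈ PF_m` for `R ≥ R₀(m, P)` — positivity of the solid minors

Trunk T-ANALYSIS (Literature/Analysis/TotalPositivity). Analytic half of the core of the tree's
proof of Katkova's Theorem 3 [Katkova2006, Thm. 3], continuing `ExpPolySolidMinors.lean`. For a
real polynomial `P(x) = Σ_{j ≤ r} p_j x^j` with `P(x) ≥ c₀ (1+x)^r` on `[0, ∞)` (`c₀ > 0`), the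
solid Toeplitz minors `T_{n+1}(k)` of the Maclaurin coefficients of `e^w P(w/R)`
(`expPolySeq p r R`) are positive for ALL `k ≥ 0` as soon as `R ≥ R₀(n, P)`
(`solidMinor_expPolySeq_pos`), hence (`isMultiplyPositiveSeq_of_solidMinor_pos`, the solid-minor
criterion) the coefficient sequence is `m`-times positive for `R ≥ R₀(m, P)`
(`isMultiplyPositiveSeq_expPolySeq`).

Proof. By `ExpPolySolidMinors.lean`, `(∏_b (k+n-b)!) · T_{n+1}(k) = ε · det N`, and for the
main-term matrix `m` (`x = k/R`) `ε · det m = sf(n) P(x)^{n+1} ≥ sf(n) c₀^{n+1} (1+x)^{r(n+1)}`;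
the entries satisfy `|N - m| ≤ (C₁/R)(1+x)^r`, `|m| ≤ C₂ (1+x)^r` (`abs_prod_add_sub_pow_le`),
so `|det N - det m| ≤ (C₃/R)(1+x)^{r(n+1)}` (`abs_det_sub_det_le`) and the main term wins for
`R ≥ 2C₃/(sf(n) c₀^{n+1})`, uniformly in `k`.

References: O. M. Katkova, *Multiple positivity and the Riemann zeta-function*, CMFT 7 (2007)
13–31; arXiv:math/0505174, Thm. 3, §2 (Thm. 3″, Lemma 3). [Katkova2006]
-/

noncomputable section
open Finset Matrix
namespace Literature.Analysis.TotalPositivity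

/-! ### Elementary inequalities -/

/-- `|∏_{l<j} (k + e_l) - k^j| ≤ (k+B)^j - k^j` when `k ≥ 0` and `|e_l| ≤ B`. [folklore] -/
theorem abs_prod_add_sub_pow_le {k B : ℝ} (hk : 0 ≤ k) (hB : 0 ≤ B) (e : ℕ → ℝ) (j : ℕ)
    (he : ∀ l, l < j → |e l| ≤ B) :
    |∏ l ∈ range j, (k + e l) - k ^ j| ≤ (k + B) ^ j - k ^ j := by
  induction j with
  | zero => simp
  | succ j ih =>
    have ih' := ih fun l hl => he l (Nat.lt_succ_of_lt hl)
    have hej := he j (Nat.lt_succ_self j)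
    rw [Finset.prod_range_succ, pow_succ, pow_succ]
    set P := ∏ l ∈ range j, (k + e l) with hP
    have hPabs : |P| ≤ (k + B) ^ j := by
      have h1 : |P| ≤ |P - k ^ j| + |k ^ j| := by
        have := abs_add_le (P - k ^ j) (k ^ j)
        rwa [sub_add_cancel] at this
      have h2 : |k ^ j| = k ^ j := abs_of_nonneg (pow_nonneg hk _)
      linarith
    have hsplit : P * (k + e j) - k ^ j * k = P * e j + (P - k ^ j) * k := by ring
    rw [hsplit]
    calc |P * e j + (P - k ^ j) * k| ≤ |P * e j| + |(P - k ^ j) * k| := abs_add_le _ _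
      _ = |P| * |e j| + |P - k ^ j| * k := by rw [abs_mul, abs_mul, abs_of_nonneg hk]
      _ ≤ (k + B) ^ j * B + ((k + B) ^ j - k ^ j) * k :=
          add_le_add (mul_le_mul hPabs hej (abs_nonneg _) (pow_nonneg (by linarith) _))
            (mul_le_mul_of_nonneg_right ih' hk)
      _ = (k + B) ^ j * (k + B) - k ^ j * k := by ring

/-- `(y+h)^j - y^j ≤ j h (y+h)^{j-1}` for `y, h ≥ 0` (a private copy of
`Literature.AlgebraicGeometry.Motives.add_pow_sub_pow_le`, to avoid a cross-trunk import).
[folklore] -/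
private theorem pow_add_sub_pow_le {y h : ℝ} (hy : 0 ≤ y) (hh : 0 ≤ h) (j : ℕ) :
    (y + h) ^ j - y ^ j ≤ j * h * (y + h) ^ (j - 1) := by
  have key := geom_sum₂_mul_add h y j
  -- `(Σ_{i<j} (h+y)^i y^{j-1-i}) h + y^j = (h+y)^j`
  have hS : ∑ i ∈ range j, (h + y) ^ i * y ^ (j - 1 - i) ≤ j * (h + y) ^ (j - 1) := by
    have hterm : ∀ i ∈ range j, (h + y) ^ i * y ^ (j - 1 - i) ≤ (h + y) ^ (j - 1) := by
      intro i hi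
      rw [mem_range] at hi
      calc (h + y) ^ i * y ^ (j - 1 - i) ≤ (h + y) ^ i * (h + y) ^ (j - 1 - i) :=
            mul_le_mul_of_nonneg_left (pow_le_pow_left₀ hy (by linarith) _)
              (pow_nonneg (by linarith) _)
        _ = (h + y) ^ (j - 1) := by rw [← pow_add]; congr 1; omega
    calc ∑ i ∈ range j, (h + y) ^ i * y ^ (j - 1 - i) ≤ ∑ i ∈ range j, (h + y) ^ (j - 1) :=
          Finset.sum_le_sum hterm
      _ = j * (h + y) ^ (j - 1) := by rw [Finset.sum_const, card_range, nsmul_eq_mul]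
  have hSh := mul_le_mul_of_nonneg_right hS hh
  rw [add_comm y h, ← key]
  nlinarith [hSh]

/-- **Perturbation of products**: `|∏ g - ∏ f| ≤ (μ+δ)^#s - μ^#s` (`|f| ≤ μ`, `|g - f| ≤ δ`).
[folklore] -/
theorem abs_prod_sub_prod_le {ι : Type*} [DecidableEq ι] (s : Finset ι) (f g : ι → ℝ) {μ δ : ℝ}
    (hμ : 0 ≤ μ) (hδ : 0 ≤ δ) (hf : ∀ i ∈ s, |f i| ≤ μ) (hg : ∀ i ∈ s, |g i - f i| ≤ δ) :
    |∏ i ∈ s, g i - ∏ i ∈ s, f i| ≤ (μ + δ) ^ s.card - μ ^ s.card := by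
  induction s using Finset.induction_on with
  | empty => simp
  | insert a s ha ih =>
    have hf' : ∀ i ∈ s, |f i| ≤ μ := fun i hi => hf i (mem_insert_of_mem hi)
    have hg' : ∀ i ∈ s, |g i - f i| ≤ δ := fun i hi => hg i (mem_insert_of_mem hi)
    have ih' := ih hf' hg'
    have hfa := hf a (mem_insert_self a s)
    have hga := hg a (mem_insert_self a s)
    rw [Finset.prod_insert ha, Finset.prod_insert ha, Finset.card_insert_of_notMem ha, pow_succ,
      pow_succ]
    have hPf : |∏ i ∈ s, f i| ≤ μ ^ s.card := by
      rw [Finset.abs_prod]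
      calc ∏ i ∈ s, |f i| ≤ ∏ _i ∈ s, μ := Finset.prod_le_prod (fun i _ => abs_nonneg _) hf'
        _ = μ ^ s.card := Finset.prod_const μ
    have hga' : |g a| ≤ μ + δ := by
      have := abs_add_le (f a) (g a - f a)
      rw [add_sub_cancel] at this
      linarith
    have hsplit : g a * ∏ i ∈ s, g i - f a * ∏ i ∈ s, f i =
        g a * (∏ i ∈ s, g i - ∏ i ∈ s, f i) + (g a - f a) * ∏ i ∈ s, f i := by ring
    rw [hsplit]
    have hμδ : 0 ≤ (μ + δ) ^ s.card - μ ^ s.card := by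
      have := pow_le_pow_left₀ hμ (by linarith : μ ≤ μ + δ) s.card
      linarith
    calc |g a * (∏ i ∈ s, g i - ∏ i ∈ s, f i) + (g a - f a) * ∏ i ∈ s, f i|
        ≤ |g a * (∏ i ∈ s, g i - ∏ i ∈ s, f i)| + |(g a - f a) * ∏ i ∈ s, f i| := abs_add_le _ _
      _ = |g a| * |∏ i ∈ s, g i - ∏ i ∈ s, f i| + |g a - f a| * |∏ i ∈ s, f i| := by
          rw [abs_mul, abs_mul]
      _ ≤ (μ + δ) * ((μ + δ) ^ s.card - μ ^ s.card) + δ * μ ^ s.card :=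
          add_le_add (mul_le_mul hga' ih' (abs_nonneg _) (by linarith))
            (mul_le_mul hga hPf (abs_nonneg _) hδ)
      _ = (μ + δ) ^ s.card * (μ + δ) - μ ^ s.card * μ := by ring

/-- **Perturbation of determinants**: `|det M' - det M| ≤ N! · ((μ+δ)^N - μ^N)`. [folklore] -/
theorem abs_det_sub_det_le {N : ℕ} (M M' : Matrix (Fin N) (Fin N) ℝ) {μ δ : ℝ} (hμ : 0 ≤ μ)
    (hδ : 0 ≤ δ) (hM : ∀ i j, |M i j| ≤ μ) (hM' : ∀ i j, |M' i j - M i j| ≤ δ) :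
    |M'.det - M.det| ≤ (N.factorial : ℝ) * ((μ + δ) ^ N - μ ^ N) := by
  rw [Matrix.det_apply', Matrix.det_apply', ← Finset.sum_sub_distrib]
  refine (Finset.abs_sum_le_sum_abs _ _).trans ?_
  have hterm : ∀ σ : Equiv.Perm (Fin N),
      |((Equiv.Perm.sign σ : ℤ) : ℝ) * ∏ i, M' (σ i) i - ((Equiv.Perm.sign σ : ℤ) : ℝ) * ∏ i, M (σ i) i|
        ≤ (μ + δ) ^ N - μ ^ N := by
    intro σ
    rw [← mul_sub, abs_mul]
    have hs : |((Equiv.Perm.sign σ : ℤ) : ℝ)| = 1 := by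
      rcases Int.units_eq_one_or (Equiv.Perm.sign σ) with h | h <;> simp [h]
    rw [hs, one_mul]
    have := abs_prod_sub_prod_le (Finset.univ : Finset (Fin N)) (fun i => M (σ i) i)
      (fun i => M' (σ i) i) hμ hδ (fun i _ => hM _ _) (fun i _ => hM' _ _)
    rwa [Finset.card_univ, Fintype.card_fin] at this
  calc ∑ σ : Equiv.Perm (Fin N),
        |((Equiv.Perm.sign σ : ℤ) : ℝ) * ∏ i, M' (σ i) i - ((Equiv.Perm.sign σ : ℤ) : ℝ) * ∏ i, M (σ i) i|
      ≤ ∑ _σ : Equiv.Perm (Fin N), ((μ + δ) ^ N - μ ^ N) := Finset.sum_le_sum fun σ _ => hterm σ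
    _ = (N.factorial : ℝ) * ((μ + δ) ^ N - μ ^ N) := by
        rw [Finset.sum_const, Finset.card_univ, Fintype.card_perm, Fintype.card_fin, nsmul_eq_mul]

/-! ### Entry bounds -/

/-- The descending factorial `(k+n-b)(k+n-b-1)⋯(k+n-b-j+1)` differs from `k^j` by at most
`(k+B)^j - k^j`, `B = n + r` (`b ≤ n`, `j ≤ r`). [folklore] -/
theorem abs_desc_sub_pow_le (k : ℕ) {n r j : ℕ} (b : ℕ) (hj : j ≤ r) :
    |∏ l ∈ range j, (((k + (n - b) : ℕ) : ℝ) - l) - (k : ℝ) ^ j| ≤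
      ((k : ℝ) + (n + r)) ^ j - (k : ℝ) ^ j := by
  have he : ∀ l, l < j → |(((n - b : ℕ) : ℝ) - l)| ≤ (n : ℝ) + r := by
    intro l hl
    rw [abs_le]
    have h1 : ((n - b : ℕ) : ℝ) ≤ n := by exact_mod_cast Nat.sub_le n b
    have h2 : (0 : ℝ) ≤ ((n - b : ℕ) : ℝ) := by positivity
    have h3 : (l : ℝ) ≤ r := by exact_mod_cast (by omega : l ≤ r)
    have h4 : (0 : ℝ) ≤ l := by positivity
    have h5 : (0 : ℝ) ≤ n := by positivity
    constructor <;> linarith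
  have h := abs_prod_add_sub_pow_le (k := (k : ℝ)) (B := (n : ℝ) + r) (by positivity)
    (by positivity) (fun l => ((n - b : ℕ) : ℝ) - l) j he
  convert h using 4 with l
  push_cast
  ring

/-- `|N_{b,a} - m_{b,a}| ≤ (C₁/R) (1 + k/R)^r` for `R ≥ 1` (`C₁` explicit). [folklore] -/
theorem abs_scaledMatrix_sub_mainMatrix_le (p : ℕ → ℝ) (r n : ℕ) {R : ℝ} (hR : 1 ≤ R) (k : ℕ)
    (b a : Fin (n + 1)) :
    |scaledMatrix p r R n k b a - mainMatrix p r n (k / R) b a| ≤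
      (∑ j ∈ range (r + 1), |p j|) * ((r : ℝ) * (n + r) * (1 + (n + r)) ^ r) *
        (1 + ((n : ℝ) + r)) ^ n / R * (1 + k / R) ^ r := by
  have hR0 : 0 < R := lt_of_lt_of_le one_pos hR
  set x : ℝ := k / R with hx
  have hx0 : 0 ≤ x := by positivity
  set B : ℝ := (n : ℝ) + r with hB
  have hB0 : 0 ≤ B := by positivity
  have hb : (b : ℕ) ≤ n := Nat.lt_succ_iff.1 b.2
  simp only [scaledMatrix, mainMatrix, Matrix.of_apply]
  rw [← Finset.sum_sub_distrib]
  refine (Finset.abs_sum_le_sum_abs _ _).trans ?_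
  -- the two factor bounds
  have hfac1 : ∀ j ∈ range (r + 1),
      |R⁻¹ ^ j * ∏ l ∈ range j, (((k + (n - (b : ℕ)) : ℕ) : ℝ) - l) - x ^ j| ≤
        (r : ℝ) * B * (1 + B) ^ r / R * (1 + x) ^ r := by
    intro j hj
    rw [mem_range, Nat.lt_succ_iff] at hj
    have hxj : x ^ j = R⁻¹ ^ j * (k : ℝ) ^ j := by
      rw [hx, div_eq_mul_inv, mul_pow, mul_comm]
    rw [hxj, ← mul_sub, abs_mul, abs_of_nonneg (pow_nonneg (inv_nonneg.2 hR0.le) _)]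
    have h1 := abs_desc_sub_pow_le (n := n) k (b : ℕ) hj
    have h2 : R⁻¹ ^ j * |∏ l ∈ range j, (((k + (n - (b : ℕ)) : ℕ) : ℝ) - l) - (k : ℝ) ^ j| ≤
        (x + B / R) ^ j - x ^ j := by
      calc R⁻¹ ^ j * |∏ l ∈ range j, (((k + (n - (b : ℕ)) : ℕ) : ℝ) - l) - (k : ℝ) ^ j|
          ≤ R⁻¹ ^ j * (((k : ℝ) + (n + r)) ^ j - (k : ℝ) ^ j) :=
            mul_le_mul_of_nonneg_left h1 (pow_nonneg (inv_nonneg.2 hR0.le) _)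
        _ = (x + B / R) ^ j - x ^ j := by
            rw [mul_sub, ← mul_pow, ← mul_pow, hB, hx]
            congr 2 <;> ring
    refine h2.trans ?_
    have h3 := pow_add_sub_pow_le hx0 (div_nonneg hB0 hR0.le) j
    have h4 : (x + B / R) ^ (j - 1) ≤ ((1 + x) * (1 + B)) ^ r := by
      have hbase : x + B / R ≤ (1 + x) * (1 + B) := by
        have : B / R ≤ B := div_le_self hB0 hR
        nlinarith
      calc (x + B / R) ^ (j - 1) ≤ ((1 + x) * (1 + B)) ^ (j - 1) :=
            pow_le_pow_left₀ (by positivity) hbase _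
        _ ≤ ((1 + x) * (1 + B)) ^ r :=
            pow_le_pow_right₀ (by nlinarith) (by omega)
    have hj' : (j : ℝ) ≤ r := by exact_mod_cast hj
    have h5 : (j : ℝ) * (B / R) * (x + B / R) ^ (j - 1) ≤ (r : ℝ) * (B / R) * ((1 + x) * (1 + B)) ^ r := by
      have hBR : 0 ≤ B / R := div_nonneg hB0 hR0.le
      have hp : 0 ≤ (x + B / R) ^ (j - 1) := pow_nonneg (by positivity) _
      calc (j : ℝ) * (B / R) * (x + B / R) ^ (j - 1) ≤ (r : ℝ) * (B / R) * (x + B / R) ^ (j - 1) := by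
            gcongr
        _ ≤ (r : ℝ) * (B / R) * ((1 + x) * (1 + B)) ^ r :=
            mul_le_mul_of_nonneg_left h4 (by positivity)
    calc (x + B / R) ^ j - x ^ j ≤ (j : ℝ) * (B / R) * (x + B / R) ^ (j - 1) := h3
      _ ≤ (r : ℝ) * (B / R) * ((1 + x) * (1 + B)) ^ r := h5
      _ = (r : ℝ) * B * (1 + B) ^ r / R * (1 + x) ^ r := by rw [mul_pow]; field_simp
  have hfac2 : ∀ j ∈ range (r + 1), |(-((b : ℝ) + j)) ^ (a : ℕ)| ≤ (1 + B) ^ n := by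
    intro j hj
    rw [mem_range, Nat.lt_succ_iff] at hj
    rw [abs_pow, abs_neg]
    have hbj : |(b : ℝ) + j| ≤ 1 + B := by
      rw [abs_of_nonneg (by positivity), hB]
      have h1 : ((b : ℕ) : ℝ) ≤ n := by exact_mod_cast hb
      have h2 : (j : ℝ) ≤ r := by exact_mod_cast hj
      linarith
    calc |(b : ℝ) + j| ^ (a : ℕ) ≤ (1 + B) ^ (a : ℕ) := pow_le_pow_left₀ (abs_nonneg _) hbj _
      _ ≤ (1 + B) ^ n := pow_le_pow_right₀ (by linarith) (Nat.lt_succ_iff.1 a.2)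
  -- termwise
  have hterm : ∀ j ∈ range (r + 1),
      |p j * R⁻¹ ^ j * (∏ l ∈ range j, (((k + (n - (b : ℕ)) : ℕ) : ℝ) - l)) * (-((b : ℝ) + j)) ^ (a : ℕ)
        - p j * x ^ j * (-((b : ℝ) + j)) ^ (a : ℕ)| ≤
        |p j| * ((r : ℝ) * B * (1 + B) ^ r / R * (1 + x) ^ r) * (1 + B) ^ n := by
    intro j hj
    have hsplit : p j * R⁻¹ ^ j * (∏ l ∈ range j, (((k + (n - (b : ℕ)) : ℕ) : ℝ) - l)) *
        (-((b : ℝ) + j)) ^ (a : ℕ) - p j * x ^ j * (-((b : ℝ) + j)) ^ (a : ℕ) =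
        p j * (R⁻¹ ^ j * ∏ l ∈ range j, (((k + (n - (b : ℕ)) : ℕ) : ℝ) - l) - x ^ j) *
          (-((b : ℝ) + j)) ^ (a : ℕ) := by ring
    rw [hsplit, abs_mul, abs_mul]
    exact mul_le_mul (mul_le_mul_of_nonneg_left (hfac1 j hj) (abs_nonneg _)) (hfac2 j hj)
      (abs_nonneg _) (mul_nonneg (abs_nonneg _) (by positivity))
  refine (Finset.sum_le_sum hterm).trans ?_
  rw [← Finset.sum_mul, ← Finset.sum_mul]
  apply le_of_eq
  rw [hB]
  ring

/-- `|m_{b,a}| ≤ C₂ (1+x)^r` for `x ≥ 0`, with `C₂ = (Σ_j |p_j|) (1+n+r)^n`. [folklore] -/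
theorem abs_mainMatrix_le (p : ℕ → ℝ) (r n : ℕ) {x : ℝ} (hx : 0 ≤ x) (b a : Fin (n + 1)) :
    |mainMatrix p r n x b a| ≤ (∑ j ∈ range (r + 1), |p j|) * (1 + ((n : ℝ) + r)) ^ n * (1 + x) ^ r := by
  have hb : (b : ℕ) ≤ n := Nat.lt_succ_iff.1 b.2
  simp only [mainMatrix, Matrix.of_apply]
  refine (Finset.abs_sum_le_sum_abs _ _).trans ?_
  have hterm : ∀ j ∈ range (r + 1), |p j * x ^ j * (-((b : ℝ) + j)) ^ (a : ℕ)| ≤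
      |p j| * ((1 + ((n : ℝ) + r)) ^ n * (1 + x) ^ r) := by
    intro j hj
    rw [mem_range, Nat.lt_succ_iff] at hj
    rw [abs_mul, abs_mul, mul_assoc]
    refine mul_le_mul_of_nonneg_left ?_ (abs_nonneg _)
    rw [mul_comm]
    refine mul_le_mul ?_ ?_ (abs_nonneg _) (by positivity)
    · rw [abs_pow, abs_neg, abs_of_nonneg (by positivity)]
      have h1 : ((b : ℕ) : ℝ) ≤ n := by exact_mod_cast hb
      have h2 : (j : ℝ) ≤ r := by exact_mod_cast hj
      calc ((b : ℝ) + j) ^ (a : ℕ) ≤ (1 + ((n : ℝ) + r)) ^ (a : ℕ) :=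
            pow_le_pow_left₀ (by positivity) (by linarith) _
        _ ≤ (1 + ((n : ℝ) + r)) ^ n := pow_le_pow_right₀ (by linarith [h1, h2]) (Nat.lt_succ_iff.1 a.2)
    · rw [abs_pow, abs_of_nonneg hx]
      calc x ^ j ≤ (1 + x) ^ j := pow_le_pow_left₀ hx (by linarith) _
        _ ≤ (1 + x) ^ r := pow_le_pow_right₀ (by linarith) hj
  refine (Finset.sum_le_sum hterm).trans ?_
  rw [← Finset.sum_mul]
  apply le_of_eq
  ring

/-! ### Positivity of the solid minors -/

/-- `sf(n) = 1!·2!⋯n! > 0`. [folklore] -/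
theorem superFactorial_pos' (n : ℕ) : 0 < n.superFactorial := by
  induction n with
  | zero => simp [Nat.superFactorial]
  | succ n ih => rw [Nat.superFactorial_succ]; exact Nat.mul_pos (Nat.factorial_pos _) ih
/-- **The solid minors of the coefficients of `e^w P(w/R)` are positive for `R ≥ R₀(n, P)`,
uniformly in `k ≥ 0`**, when `P(x) ≥ c₀ (1+x)^r` on `[0,∞)` with `c₀ > 0`.
[cite: Katkova2006, Thm. 3 (tree proof; replaces Prop. 2)] -/
theorem solidMinor_expPolySeq_pos (p : ℕ → ℝ) (r n : ℕ) {c₀ : ℝ} (hc₀ : 0 < c₀)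
    (hP : ∀ x : ℝ, 0 ≤ x → c₀ * (1 + x) ^ r ≤ ∑ j ∈ range (r + 1), p j * x ^ j) :
    ∃ R₀ : ℝ, ∀ R : ℝ, R₀ ≤ R → ∀ k : ℕ, 0 < solidMinor (expPolySeq p r R) (n + 1) k := by
  -- the constants
  set A : ℝ := ∑ j ∈ range (r + 1), |p j| with hA
  set B : ℝ := (n : ℝ) + r with hB
  set C₁ : ℝ := A * ((r : ℝ) * (n + r) * (1 + (n + r)) ^ r) * (1 + ((n : ℝ) + r)) ^ n with hC₁
  set C₂ : ℝ := A * (1 + ((n : ℝ) + r)) ^ n with hC₂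
  set C₃ : ℝ := ((n + 1).factorial : ℝ) * ((n + 1 : ℝ) * C₁ * (C₂ + C₁) ^ n) with hC₃
  set S : ℝ := (n.superFactorial : ℝ) * c₀ ^ (n + 1) with hS
  have hA0 : 0 ≤ A := Finset.sum_nonneg fun j _ => abs_nonneg _
  have hC₁0 : 0 ≤ C₁ := by positivity
  have hC₂0 : 0 ≤ C₂ := by positivity
  have hC₃0 : 0 ≤ C₃ := by positivity
  have hS0 : 0 < S := by
    have : 0 < (n.superFactorial : ℝ) := by exact_mod_cast superFactorial_pos' n
    positivity
  refine ⟨max 1 (2 * C₃ / S), fun R hR k => ?_⟩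
  have hR1 : 1 ≤ R := le_trans (le_max_left _ _) hR
  have hR0 : 0 < R := lt_of_lt_of_le one_pos hR1
  have hRC : C₃ / R ≤ S / 2 := by
    have h1 : 2 * C₃ / S ≤ R := le_trans (le_max_right _ _) hR
    rw [div_le_iff₀ hR0]
    rw [div_le_iff₀ hS0] at h1
    linarith
  set x : ℝ := k / R with hx
  have hx0 : 0 ≤ x := by positivity
  set y : ℝ := (1 + x) ^ r with hy
  have hy1 : 1 ≤ y := one_le_pow₀ (by linarith)
  have hy0 : 0 < y := by linarith
  -- main term
  have hmain : S * y ^ (n + 1) ≤ revSign n * (mainMatrix p r n x).det := by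
    rw [sign_rev_mul_det_mainMatrix, hS, hy, ← pow_mul, mul_assoc]
    refine mul_le_mul_of_nonneg_left ?_ (by positivity)
    rw [pow_mul, ← mul_pow]
    exact pow_le_pow_left₀ (by positivity) (hP x hx0) _
  -- error term
  have hμ : ∀ i j, |mainMatrix p r n x i j| ≤ C₂ * y := fun i j => by
    rw [hC₂, hy]; exact abs_mainMatrix_le p r n hx0 i j
  have hδ : ∀ i j, |scaledMatrix p r R n k i j - mainMatrix p r n x i j| ≤ C₁ / R * y := fun i j => by
    rw [hC₁, hy, hx]; exact abs_scaledMatrix_sub_mainMatrix_le p r n hR1 k i j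
  have herr : |(scaledMatrix p r R n k).det - (mainMatrix p r n x).det| ≤ C₃ / R * y ^ (n + 1) := by
    have h1 := abs_det_sub_det_le (mainMatrix p r n x) (scaledMatrix p r R n k)
      (by positivity : 0 ≤ C₂ * y) (by positivity : 0 ≤ C₁ / R * y) hμ hδ
    refine h1.trans ?_
    have h2 := pow_add_sub_pow_le (by positivity : 0 ≤ C₂ * y) (by positivity : 0 ≤ C₁ / R * y) (n + 1)
    simp only [Nat.add_sub_cancel] at h2
    have h3 : (C₂ * y + C₁ / R * y) ^ n ≤ ((C₂ + C₁) * y) ^ n := by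
      refine pow_le_pow_left₀ (by positivity) ?_ _
      have : C₁ / R ≤ C₁ := div_le_self hC₁0 hR1
      nlinarith
    have h4 : ((n + 1 : ℕ) : ℝ) * (C₁ / R * y) * (C₂ * y + C₁ / R * y) ^ n ≤
        ((n + 1 : ℕ) : ℝ) * (C₁ / R * y) * ((C₂ + C₁) * y) ^ n :=
      mul_le_mul_of_nonneg_left h3 (by positivity)
    have h5 : ((n + 1).factorial : ℝ) * ((C₂ * y + C₁ / R * y) ^ (n + 1) - (C₂ * y) ^ (n + 1)) ≤
        ((n + 1).factorial : ℝ) * (((n + 1 : ℕ) : ℝ) * (C₁ / R * y) * ((C₂ + C₁) * y) ^ n) :=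
      mul_le_mul_of_nonneg_left (h2.trans h4) (by positivity)
    refine h5.trans (le_of_eq ?_)
    rw [hC₃, mul_pow, pow_succ]
    push_cast
    ring
  -- combine
  have hscaled : S / 2 * y ^ (n + 1) ≤ revSign n * (scaledMatrix p r R n k).det := by
    have h1 : revSign n * (scaledMatrix p r R n k).det =
        revSign n * (mainMatrix p r n x).det +
          revSign n * ((scaledMatrix p r R n k).det - (mainMatrix p r n x).det) := by ring
    have h2 : -(C₃ / R * y ^ (n + 1)) ≤
        revSign n * ((scaledMatrix p r R n k).det - (mainMatrix p r n x).det) := by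
      have h3 : |revSign n * ((scaledMatrix p r R n k).det - (mainMatrix p r n x).det)| ≤
          C₃ / R * y ^ (n + 1) := by
        rw [abs_mul, abs_revSign, one_mul]
        exact herr
      have := neg_abs_le (revSign n * ((scaledMatrix p r R n k).det - (mainMatrix p r n x).det))
      linarith
    have h4 : C₃ / R * y ^ (n + 1) ≤ S / 2 * y ^ (n + 1) :=
      mul_le_mul_of_nonneg_right hRC (by positivity)
    rw [h1]
    linarith
  have hpos : 0 < revSign n * (scaledMatrix p r R n k).det :=
    lt_of_lt_of_le (by positivity) hscaled
  -- back to the solid minor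
  have hPi : 0 < ∏ b : Fin (n + 1), (((k + (n - (b : ℕ))).factorial : ℕ) : ℝ) :=
    Finset.prod_pos fun b _ => by exact_mod_cast Nat.factorial_pos _
  have hrel : revSign n * (scaledMatrix p r R n k).det =
      (∏ b : Fin (n + 1), (((k + (n - (b : ℕ))).factorial : ℕ) : ℝ)) *
        solidMinor (expPolySeq p r R) (n + 1) k := by
    rw [solidMinor, toeplitzMinor_expPolySeq, det_scaledMatrix]
    ring
  rw [hrel] at hpos
  exact pos_of_mul_pos_right hpos hPi.le

/-- **`e^w P(w/R) ∈ PF_m` for `R ≥ R₀(m, P)`**: all solid minors of order `≤ m` are positive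
for `R` large (`solidMinor_expPolySeq_pos`), and the solid-minor criterion
(`isMultiplyPositiveSeq_of_solidMinor_pos`, Katkova's Lemma 3) applies.
[cite: Katkova2006, Thm. 3 (Thm. 3″ for f²_ε)] -/
theorem isMultiplyPositiveSeq_expPolySeq (p : ℕ → ℝ) (r : ℕ) {c₀ : ℝ} (hc₀ : 0 < c₀)
    (hP : ∀ x : ℝ, 0 ≤ x → c₀ * (1 + x) ^ r ≤ ∑ j ∈ range (r + 1), p j * x ^ j) (m : ℕ) :
    ∃ R₀ : ℝ, ∀ R : ℝ, R₀ ≤ R → IsMultiplyPositiveSeq m (expPolySeq p r R) := by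
  -- `R₀` working for all orders `ν ≤ m` simultaneously
  have key : ∀ m : ℕ, ∃ R₀ : ℝ, ∀ R : ℝ, R₀ ≤ R → ∀ ν, 1 ≤ ν → ν ≤ m → ∀ k : ℕ,
      0 < solidMinor (expPolySeq p r R) ν k := by
    intro m
    induction m with
    | zero => exact ⟨0, fun R _ ν h1 h0 => by omega⟩
    | succ m ih =>
      obtain ⟨R₁, hR₁⟩ := ih
      obtain ⟨R₂, hR₂⟩ := solidMinor_expPolySeq_pos p r m hc₀ hP
      refine ⟨max R₁ R₂, fun R hR ν h1 hν k => ?_⟩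
      rcases Nat.lt_succ_iff_lt_or_eq.1 (Nat.lt_succ_iff.2 hν) with hlt | rfl
      · exact hR₁ R (le_trans (le_max_left _ _) hR) ν h1 (Nat.lt_succ_iff.1 hlt) k
      · exact hR₂ R (le_trans (le_max_right _ _) hR) k
  obtain ⟨R₀, hR₀⟩ := key m
  exact ⟨R₀, fun R hR => isMultiplyPositiveSeq_of_solidMinor_pos (hR₀ R hR)⟩
end Literature.Analysis.TotalPositivity
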